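import Summits.Ventures.PercRepro.RankLevelSetLevelSevenPartThree
import Summits.Ventures.PercRepro.RankLevelSetLevelSixHeavySq39U

/-!
# PercRepro — THEOREM C₇ AT `148`: C-025 AT LEVEL `7` FOR EVERY FINITE MATROID AND EVERY `p ≥ 148`, UNCONDITIONAL
(p4, gen 16; a feeder for sub-claim S4, owner p9)

The level-`7` partition chain (RankLevelSetLevelSevenPartThree d2141) gives level `7` for all `p ≥ 148` from level `6` for all
`p ≥ 147` (`c025_seven_of_six_part3`); the tree has level `6` for every `p ≥ 39` (p8's `c025_six_large_thirty_nine`,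
RankLevelSetLevelSixHeavySq39U d2067, the `39` row of ADDENDUM 48). Composed: level `7` for every `p ≥ 148` — the chain's own
floor (binding corank `d = 33` at `p = 147`), replacing the `176` of `c025_seven_large_part3'` (which went through p8's `175` row).
Axioms: standard.
-/

open scoped Matroid

namespace PercRepro

namespace ThmN

variable {α : Type}

/-- **THEOREM C₇ AT `148`, UNCONDITIONAL OVER THE TREE**: every finite matroid satisfies C-025 at level `7` for every
`p ≥ 148` — level `6` for `p ≥ 39` (`c025_six_large_thirty_nine`, d2067) through the partition chain's
`c025_seven_of_six_part3` (level `6` from `147` ⇒ level `7` from `148`, d2141). -/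
theorem c025_seven_large_one_forty_eight (M : Matroid α) [M.Finite] (p : ℕ) (hp : 148 ≤ p) : RLS M p 7 :=
  c025_seven_of_six_part3 (fun M' _ p' hp' => c025_six_large_thirty_nine M' p' (by omega)) M p hp

/-- The same in the literal `C025` body: `phiK p 7 · #U(p, 7) ≤ #Y(p, 7)` for every finite matroid and every `p ≥ 148`. -/
theorem c025_seven_large_one_forty_eight' (M : Matroid α) [M.Finite] (p : ℕ) (hp : 148 ≤ p) :
    phiK p 7 * ({A : Set α | A ⊆ M.E ∧ M.eRk A = (p : ℕ∞) ∧ M.eRk (M.E \ A) = (7 : ℕ∞)}.ncard : ℚ) ≤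
      ({A : Set α | A ⊆ M.E ∧ (7 : ℕ∞) < M.eRk A ∧ M.eRk A < (p : ℕ∞)}.ncard : ℚ) :=
  c025_seven_large_one_forty_eight M p hp

end ThmN

end PercRepro
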